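import Summits.QuantumFields.YangMills.Theorems.BalabanUVNodesN14ShellSplitOfRecordMGFPart13CoPH
import Summits.QuantumFields.YangMills.Theorems.BalabanUVNodesSpineReadingOfRecord13CoPHV

/-!
# BalabanUVNodes ∕ N14 — N14's (I)-BINDER AND N19′'s EDGE AT THE **V** SPINE READING OF RECORD `crOfRecord₁₃VAt K₀ jc sh` (dag-n20-d p590105, `vol := F.side ^ 4`) — the reading
# K3⁷ **v3** (plan g81, 02f6f498332fdbee) pins on the live line: p593287 ∕ the shell-split file re-read at the V edition, the vacuum bracket (V) displayed at volume `F.side ^ 4`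

Cell `pub-ymgap` (HUMAN RULING D-0062 Track A; director-ym №197 ∕ HUMAN RULING D-0149), WIDTH SEAT `pub-ymgap-dag-n14-w2` (g2), INTENT-3; answers node00-def-RR-2 g15 READ-289b's EDITION
NOTE (p593287 §4 concludes at the v1.0 letter `vol = 1`, the V lineage n27-c p591895 ∕ p591945 ∕ p592532 displays `NE7.Core 1 (F.side ^ 4) …`) and plan g81 YMPLAN-G81-K3V3-REGISTERED
((t-V): `PinnedAtLive jc sh cr := … cr … = crOfRecord₁₃V (jc …) sh …`).  Filed `--kind proof --supports stmt-QuantumFields-20544 --as helper`.  COUNT-NEUTRAL.  THEOREMS ONLY (0 `def`);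
imports this seat's p593287 `…N14BinderAtSpineReadingOfRecord13CoPH` (+ its shell sibling `…N14ShellSplitOfRecordMGFPart13CoPH`) and dag-n20-d's `…SpineReadingOfRecord13CoPHV`
(`crOfRecord₁₃VAt`, `core_crOfRecord₁₃VAt`, `crOfRecord₁₃VAt_T_eq`) BY NAME; edits nothing.
* §1 `tiltedMeanMatching_crOfRecord₁₃VAt_of_tv` — N14's binder at the V reading's `l₀ ∕ T ∕ Bad ∕ dec` (the same objects as v1.0's; the binder does not read `vol`); `…_of_shapeDensity` — the
  SHAPE-currency edition (`η K = e^{2 r K} − 1`; n19-w2's `tiltedMeanMatching_of_shapeDensity_atKeys`).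
* §2 ★★ `core_crOfRecord₁₃VAt_of_coreZero_of_tv` — (V) at volume `F.side ^ 4` + (SH) MGF-part shell split + (I) U3's TV sentence on the shell-free class laws of record ⇒ `NE7.Core` at
  `crOfRecord₁₃VAt K₀ jc sh …`'s OWN carriers and canonical `δ`, `∧ Summable` (`coreEdge_of_coreZero_mgfForm` at `0 < F.side ^ 4`, `core_crOfRecord₁₃VAt`); the `vol = 1` and `vol = F.side ^ 4`
  displays of (V) are inter-derivable by n19's `N19CoreMetric.core_vol_one_iff` (`δ ↦ vol·δ`).
* §3 ★★ `core_crOfRecord₁₃VAt_shellSplitOfRecord_of_coreZero_of_tv` — §2 with (SH) DISCHARGED at n21-d's `shellSplitOfRecord₁₃At N K₀ ρA ρB` (the shell sibling's `mgfForm_shellA₁₃ ∕ B₁₃`,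
  `shellMeasA₁₃_le ∕ B₁₃_le`): K3⁷ v3 stub 2's N19′ conjunct at a live tuple, `cr = crOfRecord₁₃V (jc …) (shellSplitOfRecord₁₃At 2 0 ρA ρB)`, from (V) + U3's (I) ONLY, rates NOT read.

HONEST FRAMING.  Count-neutral by-name re-reading; (V) and U3's (I) are HYPOTHESIS SHAPES produced by nobody (UNPRINTED two-run statements for d = 4); pin ∕ laws displayed, claimed for no
tuple (K0⁷ OPEN); nothing of Bałaban asserted; NE7 ∕ NE1′ NOT PRINTED ∕ NOT PROVED; N14 ∕ N19 ∕ N21 NOT discharged; K3⁷ OPEN, NOT claimed; counts UNMOVED (typed 28∕28 · discharged 5∕27, A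
5∕28); one finite four-torus programme at fixed `ε` — the YM mass gap (Clay) is NOT proved by any of this: R4 closes only the conditional finite-𝕋⁴ rung `BalabanLadder.UV`; NOT ℝ⁴, NOT OS, NOT
a mass gap, NOT Clay.  0 `def`, 0 `sorry`, standard axioms; no decl below carries a cite tag.
-/

set_option autoImplicit false

noncomputable section
open MeasureTheory ProbabilityTheory Finset
open scoped ENNReal BigOperators Matrix.Norms.L2Operator

namespace YMDAG.N14.AtSpineReading13CoPH.V

open Literature.MathematicalPhysics.QuantumFieldTheory.Balaban1983to89
open Literature.MathematicalPhysics.QuantumFieldTheory.Balaban1983to89.T4Continuum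
open Literature.MathematicalPhysics.QuantumFieldTheory.Balaban1983to89.Node00
open B14.Eq218Concrete
open Summit.QuantumFields.BalabanUV.T4Continuum.Spine
open Summit.QuantumFields.BalabanUV.T4Continuum.NE1p.DressedMGFForm (MGFForm TiltedMeanMatching)
open Summit.QuantumFields.YangMills.BalabanUVNodes.N19ShapeFaceN14AtRecordTV (tiltedMeanMatching_of_tv_atKeys)
open Summit.QuantumFields.YangMills.BalabanUVNodes.N19ShapeFaceN14AtRecord (tiltedMeanMatching_of_shapeDensity_atKeys)
open Summit.QuantumFields.YangMills.BalabanUVNodes.N19VacuumMGFRoad (coreEdge_of_coreZero_mgfForm)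
open YMDAG.UVSplit
open YMDAG.N14.AtSpineReading13CoPH

variable {F : T4Family} {N : ℕ} [NeZero N] (θ : Stage13HParams F N) (hP : θ.Provisos₁₃CoPH F N) (K₀ : ℕ) (jcut : ℕ → ℕ) (sh : ShellSplit₁₃CoPH N K₀)

/-! ## §1 N14's binder at the V reading (the binder does not read `vol`) -/

/-- **N14's BINDER AT THE V READING OF RECORD** `crOfRecord₁₃VAt K₀ jcut sh` (dag-n20-d's edition with the physical volume letter `vol := F.side ^ 4`, the record pointer of the V
lineage): same `l₀ ∕ T ∕ Bad ∕ dec` as the v1.0 reading (`crOfRecord₁₃VAt_T_eq` is `rfl`), and `TiltedMeanMatching` does not read `vol` — p593287's `tiltedMeanMatching_crOfRecord₁₃At_of_tv`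
re-read at the V reading's fields. [folklore] -/
theorem tiltedMeanMatching_crOfRecord₁₃VAt_of_tv (hζm : ZetaMeasurable F N θ.ζ) (g₀ : ℕ → ℝ) (os : List (ULoop F)) {ρ : ℕ → ℝ}
    (hTV : letI : DecidableEq (Σ K, SiteSeqKey F (K₀ + K)) := Classical.decEq _
      ∀ (K : ℕ) (t : ℝ), |t| ≤ 1 → ∀ x ∈ classSet₁₃ θ K₀ g₀ K \ badClass₁₃ θ K₀ g₀ jcut K t, ∀ S : Set (GaugeField (F.P 0) 0 (Node00.SU N)), MeasurableSet S →
        |((classMeasB₁₃ θ K₀ g₀ K x).map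
              ((T4RunLadder.unitFactorisation (datumOfRecord₁₃CoPH F N θ hP) (isPrintedAveraged_datumOfRecord₁₃CoPH F N θ hP).avgMeasurable g₀).A (K₀ + K + 1))).real S /
            ((classMeasB₁₃ θ K₀ g₀ K x).map
              ((T4RunLadder.unitFactorisation (datumOfRecord₁₃CoPH F N θ hP) (isPrintedAveraged_datumOfRecord₁₃CoPH F N θ hP).avgMeasurable g₀).A (K₀ + K + 1))).real Set.univ -
          ((classMeasA₁₃ θ K₀ g₀ K x).map
              ((T4RunLadder.unitFactorisation (datumOfRecord₁₃CoPH F N θ hP) (isPrintedAveraged_datumOfRecord₁₃CoPH F N θ hP).avgMeasurable g₀).A (K₀ + K))).real S /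
            ((classMeasA₁₃ θ K₀ g₀ K x).map
              ((T4RunLadder.unitFactorisation (datumOfRecord₁₃CoPH F N θ hP) (isPrintedAveraged_datumOfRecord₁₃CoPH F N θ hP).avgMeasurable g₀).A (K₀ + K))).real Set.univ| ≤
          ρ K) :
    letI := (crOfRecord₁₃VAt K₀ jcut sh F θ hP g₀ os).dec
    TiltedMeanMatching (crOfRecord₁₃VAt K₀ jcut sh F θ hP g₀ os).l₀ (crOfRecord₁₃VAt K₀ jcut sh F θ hP g₀ os).T (crOfRecord₁₃VAt K₀ jcut sh F θ hP g₀ os).Bad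
      (fun K (U : GaugeField (F.P (K₀ + K)) 0 (Node00.SU N)) => T4GenFunBounds.prodObs ((datumOfRecord₁₃CoPH F N θ hP).scheme g₀) (K₀ + K) os U) (classMeasA₁₃ θ K₀ g₀)
      (fun K (U : GaugeField (F.P (K₀ + K + 1)) 0 (Node00.SU N)) => T4GenFunBounds.prodObs ((datumOfRecord₁₃CoPH F N θ hP).scheme g₀) (K₀ + K + 1) os U) (classMeasB₁₃ θ K₀ g₀)
      fun K => 4 * Real.exp (2 * (crOfRecord₁₃VAt K₀ jcut sh F θ hP g₀ os).l₀) * ρ K := by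
  have h := tiltedMeanMatching_crOfRecord₁₃At_of_tv θ hP K₀ jcut sh hζm g₀ os hTV
  intro K t ht x hx u hu
  exact h K t ht x hx u hu

/-- **N14's BINDER AT THE V READING, SHAPE CURRENCY** (what a density-producing expansion hands; n19-w2's `tiltedMeanMatching_of_shapeDensity_atKeys` BY NAME): on every good key the
pushed-forward class law of run B IS `e^{c}` times run A's with a density `e^{g}`, `g` measurable, `|g| ≤ r K`, `0 ≤ r K` ⇒ `TiltedMeanMatching … (K ↦ e^{2 r K} − 1)` at the V reading's
carriers (summable when `Σ r K < ∞`, n19-w2's `summable_mul_exp_two_mul_sub_one`).  SHAPE ⇒ TV by n19-c's `N19CoreTVInvariant.tvSandwich_of_shapeSandwich`; both currencies displayed,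
neither produced. [folklore] -/
theorem tiltedMeanMatching_crOfRecord₁₃VAt_of_shapeDensity (hζm : ZetaMeasurable F N θ.ζ) (g₀ : ℕ → ℝ) (os : List (ULoop F)) {r : ℕ → ℝ}
    (hSh : letI : DecidableEq (Σ K, SiteSeqKey F (K₀ + K)) := Classical.decEq _
      ∀ (K : ℕ) (t : ℝ), |t| ≤ 1 → ∀ x ∈ classSet₁₃ θ K₀ g₀ K \ badClass₁₃ θ K₀ g₀ jcut K t,
        ∃ (c : ℝ) (g : GaugeField (F.P 0) 0 (Node00.SU N) → ℝ), Measurable g ∧ (∀ u, |g u| ≤ r K) ∧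
          (classMeasB₁₃ θ K₀ g₀ K x).map
              ((T4RunLadder.unitFactorisation (datumOfRecord₁₃CoPH F N θ hP) (isPrintedAveraged_datumOfRecord₁₃CoPH F N θ hP).avgMeasurable g₀).A (K₀ + K + 1)) =
            ENNReal.ofReal (Real.exp c) •
              ((classMeasA₁₃ θ K₀ g₀ K x).map
                ((T4RunLadder.unitFactorisation (datumOfRecord₁₃CoPH F N θ hP) (isPrintedAveraged_datumOfRecord₁₃CoPH F N θ hP).avgMeasurable g₀).A (K₀ + K))).withDensity
                fun u => ENNReal.ofReal (Real.exp (g u)))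
    (hr : ∀ K, 0 ≤ r K) :
    letI := (crOfRecord₁₃VAt K₀ jcut sh F θ hP g₀ os).dec
    TiltedMeanMatching (crOfRecord₁₃VAt K₀ jcut sh F θ hP g₀ os).l₀ (crOfRecord₁₃VAt K₀ jcut sh F θ hP g₀ os).T (crOfRecord₁₃VAt K₀ jcut sh F θ hP g₀ os).Bad
      (fun K (U : GaugeField (F.P (K₀ + K)) 0 (Node00.SU N)) => T4GenFunBounds.prodObs ((datumOfRecord₁₃CoPH F N θ hP).scheme g₀) (K₀ + K) os U) (classMeasA₁₃ θ K₀ g₀)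
      (fun K (U : GaugeField (F.P (K₀ + K + 1)) 0 (Node00.SU N)) => T4GenFunBounds.prodObs ((datumOfRecord₁₃CoPH F N θ hP).scheme g₀) (K₀ + K + 1) os U) (classMeasB₁₃ θ K₀ g₀)
      fun K => Real.exp (2 * r K) - 1 := by
  letI : DecidableEq (Σ K, SiteSeqKey F (K₀ + K)) := Classical.decEq _
  have h := tiltedMeanMatching_of_shapeDensity_atKeys (T := classSet₁₃ θ K₀ g₀) (Bad := badClass₁₃ θ K₀ g₀ jcut) (l₀ := 1) (r := r)
    (kA := fun K => K₀ + K) (kB := fun K => K₀ + K + 1) (νA := classMeasA₁₃ θ K₀ g₀) (νB := classMeasB₁₃ θ K₀ g₀)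
    (T4RunLadder.unitFactorisation (datumOfRecord₁₃CoPH F N θ hP) (isPrintedAveraged_datumOfRecord₁₃CoPH F N θ hP).avgMeasurable g₀) os
    (fun K x _ => isFiniteMeasure_classMeasA₁₃ θ K₀ hP hζm g₀ K x) hSh hr
  intro K t ht x hx u hu
  exact h K t ht x hx u hu

/-! ## §2 N19′'s edge AT THE V READING (volume letter `F.side ^ 4`) from (V) + (SH) + (I) -/

/-- **★★ N19′ ∧ U4′ AT THE V READING OF RECORD, CANONICAL RATE** — p593287 §4's `core_crOfRecord₁₃At_of_coreZero_of_tv` at dag-n20-d's V edition: (V) §N19 s1's bracket on the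
VACUUM shell-free class weights of record displayed AT VOLUME `F.side ^ 4` (`NE7.Core 1 (F.side ^ 4) …`, the V lineage's letter — n27-c p591895 ∕ p591945 ∕ p592532; inter-derivable with the
`vol = 1` display by n19's `N19CoreMetric.core_vol_one_iff`, RR-2 READ-289b), (SH) the shell split in MGF-part form, (I) U3's TV sentence on the shell-free class laws of record, `Σ ρ < ∞`
⇒ `NE7.Core` at `crOfRecord₁₃VAt K₀ jcut sh …`'s OWN carriers (`vol = F.side ^ 4`) and canonical `δ`, `∧ Summable` (`coreEdge_of_coreZero_mgfForm` at `0 < F.side ^ 4` + n20-d's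
`core_crOfRecord₁₃VAt` BY NAME; non-negative cores free). [folklore] -/
theorem core_crOfRecord₁₃VAt_of_coreZero_of_tv (E : B12.RunParams → ℝ) (hsel : θ.ppSel = ppSelLiveOfRecord F N θ.ν θ.τ9 E (wOfRecord₉ F N θ.toStage9Params))
    (hζm : ZetaMeasurable F N θ.ζ) (hζ0 : ∀ p g k s Pl Ql RS U V', 0 ≤ θ.ζ p g k s Pl Ql RS U V') (g₀ : ℕ → ℝ) (os : List (ULoop F)) {δ₀ ρ : ℕ → ℝ}
    (h0 : letI : DecidableEq (Σ K, SiteSeqKey F (K₀ + K)) := Classical.decEq _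
      NE7.Core 1 ((F.side : ℝ) ^ 4) (classSet₁₃ θ K₀ g₀) (badClass₁₃ θ K₀ g₀ jcut) (fun K _ x => weightA₁₃ θ hP K₀ g₀ os K 0 x - (sh F θ hP g₀ os).1 K 0 x)
        (fun K _ x => weightB₁₃ θ hP K₀ g₀ os K 0 x - (sh F θ hP g₀ os).2 K 0 x) δ₀)
    (hδ₀ : Summable δ₀)
    {νshA : ∀ K, (Σ K, SiteSeqKey F (K₀ + K)) → Measure (GaugeField (F.P (K₀ + K)) 0 (Node00.SU N))}
    {νshB : ∀ K, (Σ K, SiteSeqKey F (K₀ + K)) → Measure (GaugeField (F.P (K₀ + K + 1)) 0 (Node00.SU N))}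
    (hshA : MGFForm 1 (classSet₁₃ θ K₀ g₀)
      (fun K (U : GaugeField (F.P (K₀ + K)) 0 (Node00.SU N)) => T4GenFunBounds.prodObs ((datumOfRecord₁₃CoPH F N θ hP).scheme g₀) (K₀ + K) os U) νshA (sh F θ hP g₀ os).1)
    (hleA : ∀ K, ∀ x ∈ classSet₁₃ θ K₀ g₀ K, νshA K x ≤ classMeasA₁₃ θ K₀ g₀ K x)
    (hshB : MGFForm 1 (classSet₁₃ θ K₀ g₀)
      (fun K (U : GaugeField (F.P (K₀ + K + 1)) 0 (Node00.SU N)) => T4GenFunBounds.prodObs ((datumOfRecord₁₃CoPH F N θ hP).scheme g₀) (K₀ + K + 1) os U) νshB (sh F θ hP g₀ os).2)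
    (hleB : ∀ K, ∀ x ∈ classSet₁₃ θ K₀ g₀ K, νshB K x ≤ classMeasB₁₃ θ K₀ g₀ K x)
    (hTV : letI : DecidableEq (Σ K, SiteSeqKey F (K₀ + K)) := Classical.decEq _
      ∀ (K : ℕ) (t : ℝ), |t| ≤ 1 → ∀ x ∈ classSet₁₃ θ K₀ g₀ K \ badClass₁₃ θ K₀ g₀ jcut K t, ∀ S : Set (GaugeField (F.P 0) 0 (Node00.SU N)), MeasurableSet S →
        |((classMeasB₁₃ θ K₀ g₀ K x - νshB K x).map
              ((T4RunLadder.unitFactorisation (datumOfRecord₁₃CoPH F N θ hP) (isPrintedAveraged_datumOfRecord₁₃CoPH F N θ hP).avgMeasurable g₀).A (K₀ + K + 1))).real S /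
            ((classMeasB₁₃ θ K₀ g₀ K x - νshB K x).map
              ((T4RunLadder.unitFactorisation (datumOfRecord₁₃CoPH F N θ hP) (isPrintedAveraged_datumOfRecord₁₃CoPH F N θ hP).avgMeasurable g₀).A (K₀ + K + 1))).real Set.univ -
          ((classMeasA₁₃ θ K₀ g₀ K x - νshA K x).map
              ((T4RunLadder.unitFactorisation (datumOfRecord₁₃CoPH F N θ hP) (isPrintedAveraged_datumOfRecord₁₃CoPH F N θ hP).avgMeasurable g₀).A (K₀ + K))).real S /
            ((classMeasA₁₃ θ K₀ g₀ K x - νshA K x).map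
              ((T4RunLadder.unitFactorisation (datumOfRecord₁₃CoPH F N θ hP) (isPrintedAveraged_datumOfRecord₁₃CoPH F N θ hP).avgMeasurable g₀).A (K₀ + K))).real Set.univ| ≤
          ρ K)
    (hρs : Summable ρ) :
    (letI := (crOfRecord₁₃VAt K₀ jcut sh F θ hP g₀ os).dec
     NE7.Core (crOfRecord₁₃VAt K₀ jcut sh F θ hP g₀ os).l₀ (crOfRecord₁₃VAt K₀ jcut sh F θ hP g₀ os).vol (crOfRecord₁₃VAt K₀ jcut sh F θ hP g₀ os).T
      (crOfRecord₁₃VAt K₀ jcut sh F θ hP g₀ os).Bad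
      (fun K t τ => (crOfRecord₁₃VAt K₀ jcut sh F θ hP g₀ os).A K t τ - (crOfRecord₁₃VAt K₀ jcut sh F θ hP g₀ os).shA K t τ)
      (fun K t τ => (crOfRecord₁₃VAt K₀ jcut sh F θ hP g₀ os).B K t τ - (crOfRecord₁₃VAt K₀ jcut sh F θ hP g₀ os).shB K t τ)
      (crOfRecord₁₃VAt K₀ jcut sh F θ hP g₀ os).δ) ∧ Summable (crOfRecord₁₃VAt K₀ jcut sh F θ hP g₀ os).δ := by
  letI : DecidableEq (Σ K, SiteSeqKey F (K₀ + K)) := Classical.decEq _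
  have hA := (mgfForm_weightA₁₃ θ K₀ hP E hsel hζm hζ0 g₀ os).sub hshA hleA
  have hB := (mgfForm_weightB₁₃ θ K₀ hP E hsel hζm hζ0 g₀ os).sub hshB hleB
  have h := tiltedMeanMatching_of_tv_atKeys (T := classSet₁₃ θ K₀ g₀) (Bad := badClass₁₃ θ K₀ g₀ jcut) (l₀ := 1) (ρ := ρ)
    (kA := fun K => K₀ + K) (kB := fun K => K₀ + K + 1) (νA := fun K x => classMeasA₁₃ θ K₀ g₀ K x - νshA K x) (νB := fun K x => classMeasB₁₃ θ K₀ g₀ K x - νshB K x)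
    (T4RunLadder.unitFactorisation (datumOfRecord₁₃CoPH F N θ hP) (isPrintedAveraged_datumOfRecord₁₃CoPH F N θ hP).avgMeasurable g₀) os hA.finite hB.finite hTV
  have hη : TiltedMeanMatching 1 (classSet₁₃ θ K₀ g₀) (badClass₁₃ θ K₀ g₀ jcut)
      (fun K (U : GaugeField (F.P (K₀ + K)) 0 (Node00.SU N)) => T4GenFunBounds.prodObs ((datumOfRecord₁₃CoPH F N θ hP).scheme g₀) (K₀ + K) os U)
      (fun K x => classMeasA₁₃ θ K₀ g₀ K x - νshA K x)
      (fun K (U : GaugeField (F.P (K₀ + K + 1)) 0 (Node00.SU N)) => T4GenFunBounds.prodObs ((datumOfRecord₁₃CoPH F N θ hP).scheme g₀) (K₀ + K + 1) os U)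
      (fun K x => classMeasB₁₃ θ K₀ g₀ K x - νshB K x) fun K => 4 * Real.exp (2 * 1) * ρ K := by
    intro K t ht x hx u hu
    exact h K t ht x hx u hu
  obtain ⟨δ, hcore, hδ⟩ := coreEdge_of_coreZero_mgfForm (pow_pos F.side_pos 4) hA hB h0 hδ₀ hη (hρs.mul_left _)
  exact core_crOfRecord₁₃VAt K₀ jcut sh θ hP g₀ os (fun K t _ x hx => hA.nonneg' K t (Finset.mem_sdiff.1 hx).1) hcore hδ

/-! ## §3 … with (SH) DISCHARGED at n21-d's shell split of record (K3⁷ v3 stub 2's N19′ conjunct at a live tuple, `sh := shellSplitOfRecord₁₃At`) -/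

section ShellOfRecord

open Summit.QuantumFields.YangMills.Theorems.N21ShellSplitOfRecord13CoPH (shellA₁₃ shellB₁₃ shellSplitOfRecord₁₃At WidthLetter₁₃CoPH)
open YMDAG.N14.AtSpineReading13CoPH.Shell

/-- **★★ N19′ ∧ U4′ AT THE V READING `crOfRecord₁₃VAt K₀ jc (shellSplitOfRecord₁₃At N K₀ ρA ρB)`, CANONICAL RATE, FROM (V) + U3's (I) ONLY.**  At one Stage-13 tuple with core provisos on
the live-selector line (laws (H-ζ) ∕ `0 ≤ ζ` displayed), for n21-d's shell split of record with ANY width letters: (V) §N19 s1's bracket on the VACUUM shell-free class weights of record AT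
VOLUME `F.side ^ 4`, summable `δ₀`; (I) node U3's READ-OUT SENTENCE, TV currency, for the SHELL-FREE class laws of record `classMeasA₁₃ − shellMeasA₁₃` ∕ `classMeasB₁₃ − shellMeasB₁₃` pushed
to the unit lattice, `Σ ρ < ∞` ⇒ `NE7.Core` at the V reading's OWN carriers and canonical `δ`, `∧ Summable` — K3⁷ v3 `KeyedCoreEdgeHolderD4 β cr rr`'s body at the tuple for
`cr … = crOfRecord₁₃V (jc …) (shellSplitOfRecord₁₃At 2 0 ρA ρB) …` (take `K₀ := 0`, `jcut := jc F θ hP g₀ os`), rates NOT read (§2 with `hshA ∕ hleA ∕ hshB ∕ hleB :=` the shell sibling's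
`mgfForm_shellA₁₃ ∕ shellMeasA₁₃_le ∕ mgfForm_shellB₁₃ ∕ shellMeasB₁₃_le` BY NAME). [folklore] -/
theorem core_crOfRecord₁₃VAt_shellSplitOfRecord_of_coreZero_of_tv (ρA ρB : WidthLetter₁₃CoPH N)
    (E : B12.RunParams → ℝ) (hsel : θ.ppSel = ppSelLiveOfRecord F N θ.ν θ.τ9 E (wOfRecord₉ F N θ.toStage9Params))
    (hζm : ZetaMeasurable F N θ.ζ) (hζ0 : ∀ p g k s Pl Ql RS U V', 0 ≤ θ.ζ p g k s Pl Ql RS U V') (g₀ : ℕ → ℝ) (os : List (ULoop F)) {δ₀ ρ : ℕ → ℝ}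
    (h0 : letI : DecidableEq (Σ K, SiteSeqKey F (K₀ + K)) := Classical.decEq _
      NE7.Core 1 ((F.side : ℝ) ^ 4) (classSet₁₃ θ K₀ g₀) (badClass₁₃ θ K₀ g₀ jcut)
        (fun K _ x => weightA₁₃ θ hP K₀ g₀ os K 0 x - shellA₁₃ θ hP K₀ g₀ os (ρA F θ hP g₀ os) K 0 x)
        (fun K _ x => weightB₁₃ θ hP K₀ g₀ os K 0 x - shellB₁₃ θ hP K₀ g₀ os (ρB F θ hP g₀ os) K 0 x) δ₀)
    (hδ₀ : Summable δ₀)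
    (hTV : letI : DecidableEq (Σ K, SiteSeqKey F (K₀ + K)) := Classical.decEq _
      ∀ (K : ℕ) (t : ℝ), |t| ≤ 1 → ∀ x ∈ classSet₁₃ θ K₀ g₀ K \ badClass₁₃ θ K₀ g₀ jcut K t, ∀ S : Set (GaugeField (F.P 0) 0 (Node00.SU N)), MeasurableSet S →
        |((classMeasB₁₃ θ K₀ g₀ K x - shellMeasB₁₃ θ K₀ g₀ (ρB F θ hP g₀ os) K x).map
              ((T4RunLadder.unitFactorisation (datumOfRecord₁₃CoPH F N θ hP) (isPrintedAveraged_datumOfRecord₁₃CoPH F N θ hP).avgMeasurable g₀).A (K₀ + K + 1))).real S /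
            ((classMeasB₁₃ θ K₀ g₀ K x - shellMeasB₁₃ θ K₀ g₀ (ρB F θ hP g₀ os) K x).map
              ((T4RunLadder.unitFactorisation (datumOfRecord₁₃CoPH F N θ hP) (isPrintedAveraged_datumOfRecord₁₃CoPH F N θ hP).avgMeasurable g₀).A (K₀ + K + 1))).real Set.univ -
          ((classMeasA₁₃ θ K₀ g₀ K x - shellMeasA₁₃ θ K₀ g₀ (ρA F θ hP g₀ os) K x).map
              ((T4RunLadder.unitFactorisation (datumOfRecord₁₃CoPH F N θ hP) (isPrintedAveraged_datumOfRecord₁₃CoPH F N θ hP).avgMeasurable g₀).A (K₀ + K))).real S /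
            ((classMeasA₁₃ θ K₀ g₀ K x - shellMeasA₁₃ θ K₀ g₀ (ρA F θ hP g₀ os) K x).map
              ((T4RunLadder.unitFactorisation (datumOfRecord₁₃CoPH F N θ hP) (isPrintedAveraged_datumOfRecord₁₃CoPH F N θ hP).avgMeasurable g₀).A (K₀ + K))).real Set.univ| ≤
          ρ K)
    (hρs : Summable ρ) :
    (letI := (crOfRecord₁₃VAt K₀ jcut (shellSplitOfRecord₁₃At N K₀ ρA ρB) F θ hP g₀ os).dec
     NE7.Core (crOfRecord₁₃VAt K₀ jcut (shellSplitOfRecord₁₃At N K₀ ρA ρB) F θ hP g₀ os).l₀ (crOfRecord₁₃VAt K₀ jcut (shellSplitOfRecord₁₃At N K₀ ρA ρB) F θ hP g₀ os).vol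
      (crOfRecord₁₃VAt K₀ jcut (shellSplitOfRecord₁₃At N K₀ ρA ρB) F θ hP g₀ os).T (crOfRecord₁₃VAt K₀ jcut (shellSplitOfRecord₁₃At N K₀ ρA ρB) F θ hP g₀ os).Bad
      (fun K t τ => (crOfRecord₁₃VAt K₀ jcut (shellSplitOfRecord₁₃At N K₀ ρA ρB) F θ hP g₀ os).A K t τ -
        (crOfRecord₁₃VAt K₀ jcut (shellSplitOfRecord₁₃At N K₀ ρA ρB) F θ hP g₀ os).shA K t τ)
      (fun K t τ => (crOfRecord₁₃VAt K₀ jcut (shellSplitOfRecord₁₃At N K₀ ρA ρB) F θ hP g₀ os).B K t τ -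
        (crOfRecord₁₃VAt K₀ jcut (shellSplitOfRecord₁₃At N K₀ ρA ρB) F θ hP g₀ os).shB K t τ)
      (crOfRecord₁₃VAt K₀ jcut (shellSplitOfRecord₁₃At N K₀ ρA ρB) F θ hP g₀ os).δ) ∧
      Summable (crOfRecord₁₃VAt K₀ jcut (shellSplitOfRecord₁₃At N K₀ ρA ρB) F θ hP g₀ os).δ :=
  core_crOfRecord₁₃VAt_of_coreZero_of_tv θ hP K₀ jcut (shellSplitOfRecord₁₃At N K₀ ρA ρB) E hsel hζm hζ0 g₀ os h0 hδ₀
    (mgfForm_shellA₁₃ θ K₀ hP E hsel hζm hζ0 g₀ os (ρA F θ hP g₀ os)) (fun K x _ => shellMeasA₁₃_le θ K₀ hζm g₀ (ρA F θ hP g₀ os) K x)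
    (mgfForm_shellB₁₃ θ K₀ hP E hsel hζm hζ0 g₀ os (ρB F θ hP g₀ os)) (fun K x _ => shellMeasB₁₃_le θ K₀ hζm g₀ (ρB F θ hP g₀ os) K x) hTV hρs

end ShellOfRecord

end YMDAG.N14.AtSpineReading13CoPH.V

end
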